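import Literature.Analysis.FluidPDE.GavrilovSteadyEulerProofs
import Literature.Analysis.FluidPDE.VorticityCalculus

/-!
# Gavrilov's localisation with a general cutoff (support of `ChiralEddyExists`)

Helper file for item `stmt-NavierStokesRegularity-10397` (`ChiralEddyExists`, route AdiabaticEddy;
lands `--supports`).  Gavrilov's localisation principle (tree:
`Literature.Analysis.FluidPDE.Gavrilov.steadyEuler_modulate`, `exists_global_of_local`) turns a
local steady Euler flow `(U, P)` with `U·∇P = 0` into the global compactly supported flow
`Ũ = 𝟙_N · φ(P) U`, `P̃ = 𝟙_N · (Φ(P) − Φ(2ε))`, `Φ' = φ²`, for Gavrilov's specific bump `φ`.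
Here the same is done for an ARBITRARY smooth cutoff `φ` vanishing off `(ε, 2ε)`, in an abstract
setting (an open set `W` where `(U, P)` is smooth and solves the equations, a neighbourhood `N ⊇ W`,
a compact `T`, and the trichotomy `key`: every point is in `W`, or has a neighbourhood inside `N`
where `P < ε`, or a neighbourhood on which `P > 2ε` inside `N`), and in addition the vorticity of the
modulated field is computed:

* `curl Ũ = φ(P) ω + φ'(P) N`, `ω = curl U`, `N = ∇P × U` (`curl_modulate`),
* `curl curl Ũ = φ(P) curl ω + φ'(P) (∇P × ω + curl N) + φ''(P) ∇P × N` (`curl_curl_modulate`),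
* the pointwise superhelicity and helicity densities as quadratic expressions in `φ, φ', φ''`
  (`inner_curl_curl_curl_modulate`, `inner_modulate_curl_modulate`, and the polarised
  `inner_curl_plateau`).
-/

noncomputable section

set_option linter.dupNamespace false -- nested layout Summit.<S>.<Sub>, Sub = S (D-0017)

open Set Filter Function WithLp InnerProductSpace MeasureTheory
open scoped Topology RealInnerProductSpace

namespace Summit.NavierStokesRegularity.NavierStokesRegularity.Theorems.ChiralEddyExists

open Literature.Analysis.FluidPDE Literature.Analysis.FluidPDE.Gavrilov

/-! ### Cutoffs vanishing off `(ε, 2ε)` and their squared primitives -/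

section Cutoff

variable {φ : ℝ → ℝ} {ε a b : ℝ}

/-- A function vanishing on `(−∞, a] ∪ [b, ∞)` has vanishing derivative on the open set
`(−∞, a) ∪ (b, ∞)`. -/
theorem deriv_eq_zero_of_vanish (hφ0 : ∀ t, t ≤ a ∨ b ≤ t → φ t = 0) {t : ℝ}
    (ht : t < a ∨ b < t) : deriv φ t = 0 := by
  have h : φ =ᶠ[𝓝 t] fun _ => 0 := by
    rcases ht with ht | ht
    · filter_upwards [Iio_mem_nhds ht] with s hs using hφ0 s (Or.inl (le_of_lt hs))
    · filter_upwards [Ioi_mem_nhds ht] with s hs using hφ0 s (Or.inr (le_of_lt hs))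
  rw [h.deriv_eq]
  exact deriv_const t 0

/-- The second derivative of a function vanishing on `(−∞, a] ∪ [b, ∞)` vanishes on
`(−∞, a) ∪ (b, ∞)`. -/
theorem deriv_deriv_eq_zero_of_vanish (hφ0 : ∀ t, t ≤ a ∨ b ≤ t → φ t = 0) {t : ℝ}
    (ht : t < a ∨ b < t) : deriv (deriv φ) t = 0 := by
  have h : deriv φ =ᶠ[𝓝 t] fun _ => 0 := by
    rcases ht with ht | ht
    · filter_upwards [Iio_mem_nhds ht] with s hs using deriv_eq_zero_of_vanish hφ0 (Or.inl hs)
    · filter_upwards [Ioi_mem_nhds ht] with s hs using deriv_eq_zero_of_vanish hφ0 (Or.inr hs)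
  rw [h.deriv_eq]
  exact deriv_const t 0

/-- The squared primitive `Φ(t) = ∫₀ᵗ φ²` has derivative `φ²`. -/
theorem hasDerivAt_sqPrim (hφ : Continuous φ) (t : ℝ) :
    HasDerivAt (fun t => ∫ τ in (0 : ℝ)..t, φ τ ^ 2) (φ t ^ 2) t :=
  ((hφ.pow 2).integral_hasStrictDerivAt 0 t).hasDerivAt

/-- The squared primitive is smooth when `φ` is. -/
theorem contDiff_sqPrim (hφ : ContDiff ℝ (⊤ : ℕ∞) φ) :
    ContDiff ℝ (⊤ : ℕ∞) (fun t => ∫ τ in (0 : ℝ)..t, φ τ ^ 2) := by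
  rw [show ((⊤ : ℕ∞) : WithTop ℕ∞) = (⊤ : ℕ∞) from rfl, contDiff_infty_iff_deriv]
  have hd : deriv (fun t => ∫ τ in (0 : ℝ)..t, φ τ ^ 2) = fun t => φ t ^ 2 :=
    funext fun t => (hasDerivAt_sqPrim hφ.continuous t).deriv
  rw [hd]
  exact ⟨fun t => (hasDerivAt_sqPrim hφ.continuous t).differentiableAt, hφ.pow 2⟩

/-- `Φ = 0` below `ε` (for `ε ≥ 0`). -/
theorem sqPrim_of_le (hφ0 : ∀ t, t ≤ ε ∨ 2 * ε ≤ t → φ t = 0) (hε : 0 ≤ ε) {t : ℝ} (ht : t ≤ ε) :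
    ∫ τ in (0 : ℝ)..t, φ τ ^ 2 = 0 := by
  rw [intervalIntegral.integral_congr (g := fun _ => (0 : ℝ)), intervalIntegral.integral_zero]
  intro τ hτ
  have hτε : τ ≤ ε := by
    rcases le_total 0 t with h | h
    · rw [uIcc_of_le h] at hτ
      exact hτ.2.trans ht
    · rw [uIcc_of_ge h] at hτ
      exact hτ.2.trans hε
  simp [hφ0 τ (Or.inl hτε)]

/-- `Φ` is constant above `2ε`. -/
theorem sqPrim_of_ge (hφ : Continuous φ) (hφ0 : ∀ t, t ≤ ε ∨ 2 * ε ≤ t → φ t = 0) {t : ℝ}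
    (ht : 2 * ε ≤ t) :
    ∫ τ in (0 : ℝ)..t, φ τ ^ 2 = ∫ τ in (0 : ℝ)..(2 * ε), φ τ ^ 2 := by
  have hi : ∀ a b : ℝ, IntervalIntegrable (fun τ => φ τ ^ 2) volume a b :=
    fun a b => (hφ.pow 2).intervalIntegrable a b
  rw [← intervalIntegral.integral_add_adjacent_intervals (hi 0 (2 * ε)) (hi (2 * ε) t),
    intervalIntegral.integral_congr (g := fun _ => (0 : ℝ)) (a := 2 * ε),
    intervalIntegral.integral_zero, add_zero]
  intro τ hτ
  rw [uIcc_of_le ht] at hτ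
  simp [hφ0 τ (Or.inr hτ.1)]

end Cutoff

/-! ### The modulated fields in the abstract setting -/

section Modulate

variable {U : EuclideanSpace ℝ (Fin 3) → EuclideanSpace ℝ (Fin 3)} {P : EuclideanSpace ℝ (Fin 3) → ℝ}
  {W Nn : Set (EuclideanSpace ℝ (Fin 3))} {ε : ℝ} {φ : ℝ → ℝ} {x : EuclideanSpace ℝ (Fin 3)}

/-- Near a point of `W ⊆ N` (`W` open) the modulated field is `φ(P) U`. -/
theorem modulate_eventuallyEq (hW : IsOpen W) (hWN : W ⊆ Nn) (hx : x ∈ W) :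
    Nn.indicator (fun y => φ (P y) • U y) =ᶠ[𝓝 x] fun y => φ (P y) • U y := by
  filter_upwards [hW.mem_nhds hx] with y hy using indicator_of_mem (hWN hy) _

/-- Near a point of `W ⊆ N` the modulated pressure is `Φ(P) − Φ(2ε)`. -/
theorem modulateP_eventuallyEq (hW : IsOpen W) (hWN : W ⊆ Nn) (hx : x ∈ W) {Φ : ℝ → ℝ} {c : ℝ} :
    Nn.indicator (fun y => Φ (P y) - c) =ᶠ[𝓝 x] fun y => Φ (P y) - c := by
  filter_upwards [hW.mem_nhds hx] with y hy using indicator_of_mem (hWN hy) _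

/-- In a zone where `P < ε` inside `N`, or `P > 2ε` on `N`, the modulated field vanishes
identically (the cutoff vanishes off `(ε, 2ε)`). -/
theorem modulate_eventuallyEq_zero (hφ0 : ∀ t, t ≤ ε ∨ 2 * ε ≤ t → φ t = 0)
    (hz : (∀ᶠ y in 𝓝 x, y ∈ Nn ∧ P y < ε) ∨ (∀ᶠ y in 𝓝 x, y ∈ Nn → 2 * ε < P y)) :
    Nn.indicator (fun y => φ (P y) • U y) =ᶠ[𝓝 x] fun _ => 0 := by
  rcases hz with hz | hz
  · filter_upwards [hz] with y hy
    rw [indicator_of_mem hy.1]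
    simp [hφ0 _ (Or.inl hy.2.le)]
  · filter_upwards [hz] with y hy
    by_cases hyN : y ∈ Nn
    · rw [indicator_of_mem hyN]
      simp [hφ0 _ (Or.inr (hy hyN).le)]
    · exact indicator_of_notMem hyN _

/-- In the same zones the modulated pressure is locally constant. -/
theorem modulateP_eventuallyEq_const (hφ : Continuous φ) (hφ0 : ∀ t, t ≤ ε ∨ 2 * ε ≤ t → φ t = 0)
    (hε : 0 ≤ ε)
    (hz : (∀ᶠ y in 𝓝 x, y ∈ Nn ∧ P y < ε) ∨ (∀ᶠ y in 𝓝 x, y ∈ Nn → 2 * ε < P y)) :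
    ∃ c : ℝ, Nn.indicator (fun y => (∫ τ in (0 : ℝ)..(P y), φ τ ^ 2) -
      ∫ τ in (0 : ℝ)..(2 * ε), φ τ ^ 2) =ᶠ[𝓝 x] fun _ => c := by
  rcases hz with hz | hz
  · refine ⟨-(∫ τ in (0 : ℝ)..(2 * ε), φ τ ^ 2), ?_⟩
    filter_upwards [hz] with y hy
    rw [indicator_of_mem hy.1]
    simp [sqPrim_of_le hφ0 hε hy.2.le]
  · refine ⟨0, ?_⟩
    filter_upwards [hz] with y hy
    by_cases hyN : y ∈ Nn
    · rw [indicator_of_mem hyN]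
      simp [sqPrim_of_ge hφ hφ0 (hy hyN).le]
    · exact indicator_of_notMem hyN _

/-- **Smoothness of the modulated field.** -/
theorem contDiff_modulate (hW : IsOpen W) (hWN : W ⊆ Nn) (hU : ContDiffOn ℝ (⊤ : ℕ∞) U W)
    (hP : ContDiffOn ℝ (⊤ : ℕ∞) P W) (hφ : ContDiff ℝ (⊤ : ℕ∞) φ)
    (hφ0 : ∀ t, t ≤ ε ∨ 2 * ε ≤ t → φ t = 0)
    (key : ∀ x, x ∈ W ∨ (∀ᶠ y in 𝓝 x, y ∈ Nn ∧ P y < ε) ∨ (∀ᶠ y in 𝓝 x, y ∈ Nn → 2 * ε < P y)) :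
    ContDiff ℝ (⊤ : ℕ∞) (Nn.indicator fun y => φ (P y) • U y) := by
  refine contDiff_iff_contDiffAt.2 fun x => ?_
  rcases key x with hx | hz
  · have hPx : ContDiffAt ℝ (⊤ : ℕ∞) P x := hP.contDiffAt (hW.mem_nhds hx)
    have hUx : ContDiffAt ℝ (⊤ : ℕ∞) U x := hU.contDiffAt (hW.mem_nhds hx)
    have hf : ContDiffAt ℝ (⊤ : ℕ∞) (fun y => φ (P y) • U y) x :=
      (hφ.contDiffAt.comp x hPx).smul hUx
    exact hf.congr_of_eventuallyEq (modulate_eventuallyEq hW hWN hx)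
  · exact contDiffAt_const.congr_of_eventuallyEq (modulate_eventuallyEq_zero hφ0 hz)

/-- **Smoothness of the modulated pressure.** -/
theorem contDiff_modulateP (hW : IsOpen W) (hWN : W ⊆ Nn) (hP : ContDiffOn ℝ (⊤ : ℕ∞) P W)
    (hφ : ContDiff ℝ (⊤ : ℕ∞) φ) (hφ0 : ∀ t, t ≤ ε ∨ 2 * ε ≤ t → φ t = 0) (hε : 0 ≤ ε)
    (key : ∀ x, x ∈ W ∨ (∀ᶠ y in 𝓝 x, y ∈ Nn ∧ P y < ε) ∨ (∀ᶠ y in 𝓝 x, y ∈ Nn → 2 * ε < P y)) :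
    ContDiff ℝ (⊤ : ℕ∞) (Nn.indicator fun y => (∫ τ in (0 : ℝ)..(P y), φ τ ^ 2) -
      ∫ τ in (0 : ℝ)..(2 * ε), φ τ ^ 2) := by
  refine contDiff_iff_contDiffAt.2 fun x => ?_
  rcases key x with hx | hz
  · have hPx : ContDiffAt ℝ (⊤ : ℕ∞) P x := hP.contDiffAt (hW.mem_nhds hx)
    have hg : ContDiffAt ℝ (⊤ : ℕ∞) (fun y => (∫ τ in (0 : ℝ)..(P y), φ τ ^ 2) -
        ∫ τ in (0 : ℝ)..(2 * ε), φ τ ^ 2) x :=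
      ((contDiff_sqPrim hφ).contDiffAt.comp x hPx).sub contDiffAt_const
    exact hg.congr_of_eventuallyEq (modulateP_eventuallyEq hW hWN hx
      (Φ := fun t => ∫ τ in (0 : ℝ)..t, φ τ ^ 2) (c := ∫ τ in (0 : ℝ)..(2 * ε), φ τ ^ 2))
  · obtain ⟨c, hc⟩ := modulateP_eventuallyEq_const hφ.continuous hφ0 hε hz
    exact contDiffAt_const.congr_of_eventuallyEq hc

/-- **Compact support of the modulated field**: its support lies in the compact `T`. -/
theorem hasCompactSupport_modulate {T : Set (EuclideanSpace ℝ (Fin 3))} (hT : IsCompact T)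
    (hsupp : ∀ y ∈ Nn, ε < P y → P y < 2 * ε → y ∈ T)
    (hφ0 : ∀ t, t ≤ ε ∨ 2 * ε ≤ t → φ t = 0) :
    HasCompactSupport (Nn.indicator fun y => φ (P y) • U y) := by
  refine hT.of_isClosed_subset (isClosed_tsupport _) (closure_minimal (fun y hy => ?_) hT.isClosed)
  rw [mem_support] at hy
  by_cases hyN : y ∈ Nn
  · rw [indicator_of_mem hyN] at hy
    have hφy : φ (P y) ≠ 0 := fun h => hy (by simp [h])
    have h1 : ε < P y := lt_of_not_ge fun h => hφy (hφ0 _ (Or.inl h))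
    have h2 : P y < 2 * ε := lt_of_not_ge fun h => hφy (hφ0 _ (Or.inr h))
    exact hsupp y hyN h1 h2
  · exact absurd (indicator_of_notMem hyN _) hy

/-- **The modulated field is a steady Euler flow**: divergence free, `(Ũ·∇)Ũ + ∇P̃ = 0` and
`Ũ·∇P̃ = 0` everywhere. -/
theorem steadyEuler_modulate_global (hW : IsOpen W) (hWN : W ⊆ Nn) (hU : ContDiffOn ℝ (⊤ : ℕ∞) U W)
    (hP : ContDiffOn ℝ (⊤ : ℕ∞) P W) (hφ : ContDiff ℝ (⊤ : ℕ∞) φ)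
    (hφ0 : ∀ t, t ≤ ε ∨ 2 * ε ≤ t → φ t = 0) (hε : 0 ≤ ε)
    (hdiv : ∀ x ∈ W, VectorCalculus.divergence U x = 0)
    (hE : ∀ x ∈ W, convect U U x + gradient P x = 0)
    (horth : ∀ x ∈ W, fderiv ℝ P x (U x) = 0)
    (key : ∀ x, x ∈ W ∨ (∀ᶠ y in 𝓝 x, y ∈ Nn ∧ P y < ε) ∨ (∀ᶠ y in 𝓝 x, y ∈ Nn → 2 * ε < P y))
    (x : EuclideanSpace ℝ (Fin 3)) :
    VectorCalculus.divergence (Nn.indicator fun y => φ (P y) • U y) x = 0 ∧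
    convect (Nn.indicator fun y => φ (P y) • U y) (Nn.indicator fun y => φ (P y) • U y) x +
      gradient (Nn.indicator fun y => (∫ τ in (0 : ℝ)..(P y), φ τ ^ 2) -
        ∫ τ in (0 : ℝ)..(2 * ε), φ τ ^ 2) x = 0 ∧
    fderiv ℝ (Nn.indicator fun y => (∫ τ in (0 : ℝ)..(P y), φ τ ^ 2) -
        ∫ τ in (0 : ℝ)..(2 * ε), φ τ ^ 2) x (Nn.indicator (fun y => φ (P y) • U y) x) = 0 := by
  rcases key x with hx | hz
  · have hUf := modulate_eventuallyEq (U := U) (P := P) (φ := φ) hW hWN hx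
    have hPg := modulateP_eventuallyEq (P := P) hW hWN hx
      (Φ := fun t => ∫ τ in (0 : ℝ)..t, φ τ ^ 2) (c := ∫ τ in (0 : ℝ)..(2 * ε), φ τ ^ 2)
    have hPx : ContDiffAt ℝ (⊤ : ℕ∞) P x := hP.contDiffAt (hW.mem_nhds hx)
    have hUx : ContDiffAt ℝ (⊤ : ℕ∞) U x := hU.contDiffAt (hW.mem_nhds hx)
    obtain ⟨h1, h2, h3⟩ := steadyEuler_modulate (u := U) (p := P) (x := x) (φ := φ)
      (Φ := fun s => (∫ τ in (0 : ℝ)..s, φ τ ^ 2) - ∫ τ in (0 : ℝ)..(2 * ε), φ τ ^ 2)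
      (hUx.differentiableAt (by simp)) (hPx.differentiableAt (by simp))
      (hφ.contDiffAt.differentiableAt (by simp))
      ((hasDerivAt_sqPrim hφ.continuous (P x)).sub_const _) (hdiv x hx) (hE x hx) (horth x hx)
    have hfdU := hUf.fderiv_eq (𝕜 := ℝ)
    have hfdP := hPg.fderiv_eq (𝕜 := ℝ)
    have hUx' := hUf.eq_of_nhds
    refine ⟨?_, ?_, ?_⟩
    · simpa [VectorCalculus.divergence, hfdU] using h1
    · have hc : convect (Nn.indicator fun y => φ (P y) • U y) (Nn.indicator fun y => φ (P y) • U y) x =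
          convect (fun y => φ (P y) • U y) (fun y => φ (P y) • U y) x := by
        simp [convect, hfdU, hUx']
      have hg' : gradient (Nn.indicator fun y => (∫ τ in (0 : ℝ)..(P y), φ τ ^ 2) -
          ∫ τ in (0 : ℝ)..(2 * ε), φ τ ^ 2) x =
          gradient (fun y => (∫ τ in (0 : ℝ)..(P y), φ τ ^ 2) - ∫ τ in (0 : ℝ)..(2 * ε), φ τ ^ 2) x := by
        simp [gradient, hfdP]
      rw [hc, hg']
      exact h2
    · simp only [hfdP, hUx']
      exact h3
  · have hU0 := modulate_eventuallyEq_zero (U := U) hφ0 hz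
    obtain ⟨c, hPc⟩ := modulateP_eventuallyEq_const hφ.continuous hφ0 hε hz
    have hfdU : fderiv ℝ (Nn.indicator fun y => φ (P y) • U y) x = 0 := by
      rw [hU0.fderiv_eq]; exact fderiv_const_apply _
    have hfdP : fderiv ℝ (Nn.indicator fun y => (∫ τ in (0 : ℝ)..(P y), φ τ ^ 2) -
        ∫ τ in (0 : ℝ)..(2 * ε), φ τ ^ 2) x = 0 := by
      rw [hPc.fderiv_eq]; exact fderiv_const_apply _
    refine ⟨?_, ?_, ?_⟩
    · simp [VectorCalculus.divergence, hfdU]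
    · simp [convect, gradient, hfdU, hfdP]
    · simp [hfdP]

end Modulate

end Summit.NavierStokesRegularity.NavierStokesRegularity.Theorems.ChiralEddyExists
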